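import Summits.BirchSwinnertonDyer.BirchSwinnertonDyer.Theorems.KimAtThreeEulerOperatorDeterminant
import Literature.IUT.LogVolume.IntegerRingFinite
import HarnessLib

/-!
# The index of the Euler lattice `Λ = {y ∈ K : φ²y − aφy + qy ∈ 𝒪_K}` over `𝒪_K` in a `p`-adic field:
# `[Λ : 𝒪_K] = p^{v_p(q^f + 1 − D_f(a;q))}`
# (cell `bsd-addord`, seat w2-acc3 gen 7; route W2 `KimAtThreeKolyvagin`; `--supports 19679`, helper)

HONEST FRAMING.  Route W2 (`route-BirchSwinnertonDyer-KimAtThreeKolyvagin`), items 19679 / 19599, support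
item 20397 `FineKatoTauAnomalousThree` (good-ANOMALOUS rows).  This is the `p`-adic-field form of the
algebraic half of the E-side LATTICE LEMMA `log_ω E(K) = E_p(φ)⁻¹𝒪_K` (acc3 gen 6 "INDEX IDENTITY";
w2-c4 gen 9 memo §2): the pure-algebra determinant of `KimAtThreeEulerOperatorDeterminant` applied to
the valuation ring `𝒪_K` of a `p`-adic field, a free `ℤ_p`-module of rank `[K : ℚ_p]` by the tree's
`Literature.IUT.LogVolume.IntegerRingFinite` (integral closure of `ℤ_p`; scoped instances opened here).
TOOL theorems only (no definition, no named fact, no `sorry`); closes nothing; BSD is not proved by this.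

## Setting and result

`K` in the norm-side `p`-adic-field currency shared with the K-port (`KPort.Kw`):
`[NontriviallyNormedField K] [NormedAlgebra ℚ_[p] K] [IsUltrametricDist K] [ProperSpace K]`,
`𝒪_K = Valued.integer K = {‖x‖ ≤ 1}` (scoped `NormedField.toValued`).  For an isometric
`ℚ_p`-algebra endomorphism `φ` with `φ^f = 1`, `f = [K : ℚ_p]`, whose powers `φ⁰, …, φ^{f−1}` are
pairwise distinct (the Frobenius of an UNRAMIFIED `K`), and `a, q ∈ ℤ` with
`N = q^f + 1 − D_f(a; q) ≠ 0` (`D_f = Polynomial.dickson 1 q f`):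

* `relIndex_integer_eulerLattice` — **`[Λ : 𝒪_K] = p^{v_p(N)}`** for
  `Λ = {y ∈ K : (φ² − aφ + q) y ∈ 𝒪_K}` (stated as the `AddSubgroup.relIndex` of `𝒪_K` in the preimage
  of `𝒪_K` under `aeval φ (X² − aX + q)`);
* plumbing: `exists_restrict_integer` (φ restricts to a `ℤ_p`-linear `φO` on `𝒪_K`),
  `exists_pow_smul_mem_integer` (`p^n x ∈ 𝒪_K`), `coe_pow_restrict_apply`, `pow_restrict_eq_one`,
  `coe_aeval_restrict_apply`, and `linearIndependent_pow_restrict` — **Dedekind/Artin independence of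
  characters** (Mathlib `linearIndependent_monoidHom`) restricted to `𝒪_K`: the `φO^i`, `i < f`, are
  `ℤ_p`-linearly independent, so `χ_{φO} = X^f − 1`
  (`KimAtThreeEulerOperatorDeterminant.charpoly_eq_X_pow_sub_one_of_linearIndependent`).

Proof of the index: `T = aeval φO (X² − aX + q)` has `det T = N ≠ 0`
(`det_aeval_eulerPoly_of_charpoly_eq`), so `#(𝒪_K ⧸ T𝒪_K) = p^{v_p(N)}`
(`natCard_quotient_range_aeval_eulerPoly_of_charpoly_eq`); the Euler operator `T_K` on `K` is injective
hence bijective (`K` finite-dimensional over `ℚ_p`), and `y ↦ T_K y` induces `Λ/𝒪_K ≅ 𝒪_K/T𝒪_K`.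
For `a = a_p`, `q = p`: `[Λ : 𝒪_K]` is the `p`-part of `p^f + 1 − (α^f + β^f) = #Ẽ(𝔽_{p^f})` — the
digit loss of the anomalous rows.  The companion inclusion `(φ² − a_pφ + p)·log_ω E(K) ⊆ p𝒪_K` is
`Literature.NumberTheory.EllipticCurves.EulerLattice.norm_frobeniusCombination_padicLog_le`.

References: E. Artin, independence of characters (Lang, *Algebra*, VI §4 Thm. 4.1; Mathlib
`linearIndependent_monoidHom`); J.-P. Serre, *Local Fields*, II §2 (integers of a finite extension of
`ℚ_p` are finite free over `ℤ_p`); The Stacks Project, Tag 02QG.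
-/
noncomputable section

-- the cell's Theorems namespace repeats the summit name by design (D-0017)
set_option linter.dupNamespace false

open scoped NormedField
open Polynomial Module Literature.IUT.LogVolume

namespace Summit.BirchSwinnertonDyer.BirchSwinnertonDyer.Theorems.KimAtThreeEulerLatticeIndex

open Summit.BirchSwinnertonDyer.BirchSwinnertonDyer.Theorems.KimAtThreeEulerOperatorDeterminant

variable {p : ℕ} [Fact p.Prime] {K : Type*} [NontriviallyNormedField K] [NormedAlgebra ℚ_[p] K]
  [IsUltrametricDist K] [ProperSpace K]

omit [ProperSpace K] in
/-- An isometric `ℚ_p`-algebra endomorphism of `K` restricts to a `ℤ_p`-linear endomorphism of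
`𝒪_K = {‖x‖ ≤ 1}`. [folklore] -/
theorem exists_restrict_integer (φ : K →ₐ[ℚ_[p]] K) (hφ : ∀ x, ‖φ x‖ = ‖x‖) :
    ∃ φO : Valued.integer K →ₗ[ℤ_[p]] Valued.integer K, ∀ x : Valued.integer K, (φO x : K) = φ x := by
  refine ⟨{ toFun := fun x => ⟨φ x, Valued.integer.mem_iff.mpr (by rw [hφ]; exact Valued.integer.norm_le_one x)⟩
            map_add' := fun x y => by ext; simp
            map_smul' := fun c x => by
              ext
              change φ ((c : ℤ_[p]) • (x : K)) = (c : ℤ_[p]) • φ x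
              rw [← IsScalarTower.algebraMap_smul ℚ_[p] c (x : K), map_smul,
                IsScalarTower.algebraMap_smul] }, fun x => rfl⟩


omit [ProperSpace K] in
/-- Every `x ∈ K` becomes integral after multiplication by a power of `p` (`‖p^n x‖ → 0`). [folklore] -/
theorem exists_pow_smul_mem_integer (x : K) : ∃ n : ℕ, ((p : ℚ_[p]) ^ n) • x ∈ Valued.integer K := by
  by_cases hx : x = 0
  · exact ⟨0, by rw [hx, smul_zero]; exact (Valued.integer K).zero_mem⟩
  have hxpos : 0 < ‖x‖⁻¹ := inv_pos.mpr (norm_pos_iff.mpr hx)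
  obtain ⟨n, hn⟩ := exists_pow_lt_of_lt_one hxpos (Padic.norm_p_lt_one (p := p))
  refine ⟨n, Valued.integer.mem_iff.mpr ?_⟩
  rw [norm_smul, norm_pow]
  have h := mul_lt_mul_of_pos_right hn (norm_pos_iff.mpr hx)
  rw [inv_mul_cancel₀ (norm_ne_zero_iff.mpr hx)] at h
  exact h.le

omit [ProperSpace K] in
/-- Powers of the restriction are restrictions of powers. [folklore] -/
theorem coe_pow_restrict_apply (φ : K →ₐ[ℚ_[p]] K)
    (φO : Valued.integer K →ₗ[ℤ_[p]] Valued.integer K) (hφO : ∀ x : Valued.integer K, (φO x : K) = φ x)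
    (i : ℕ) (x : Valued.integer K) : ((φO ^ i) x : K) = (φ ^ i) x := by
  induction i generalizing x with
  | zero => simp
  | succ i ih => rw [pow_succ, pow_succ, Module.End.mul_apply, AlgHom.mul_apply, ih, hφO]

omit [ProperSpace K] in
/-- **Dedekind independence, integral form**: if the powers `φ⁰, …, φ^{f−1}` of a `ℚ_p`-algebra
endomorphism of `K` are pairwise distinct, the `ℤ_p`-linear endomorphisms they induce on `𝒪_K` are
linearly independent over `ℤ_p` (Artin's theorem on the independence of characters `K →* K`,
Mathlib `linearIndependent_monoidHom`, restricted from `K` to `𝒪_K`, which spans `K` over `ℚ_p`).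
[folklore] -/
theorem linearIndependent_pow_restrict (φ : K →ₐ[ℚ_[p]] K)
    (φO : Valued.integer K →ₗ[ℤ_[p]] Valued.integer K) (hφO : ∀ x : Valued.integer K, (φO x : K) = φ x)
    {f : ℕ} (hdist : ∀ i j : ℕ, i < f → j < f → (⇑(φ ^ i) : K → K) = ⇑(φ ^ j) → i = j) :
    LinearIndependent ℤ_[p] fun i : Fin f => φO ^ (i : ℕ) := by
  classical
  rw [Fintype.linearIndependent_iff]
  intro c hc i
  -- the relation, with `K`-coefficients, holds on all of `K`
  have hK : ∀ x : K, ∑ j : Fin f, algebraMap ℤ_[p] K (c j) * (φ ^ (j : ℕ)) x = 0 := by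
    intro x
    obtain ⟨n, hn⟩ := exists_pow_smul_mem_integer (p := p) x
    have h := congrArg (fun y : Valued.integer K => (y : K)) (congrFun (congrArg DFunLike.coe hc) ⟨_, hn⟩)
    simp only [LinearMap.coe_sum, Finset.sum_apply, LinearMap.smul_apply, LinearMap.zero_apply,
      ZeroMemClass.coe_zero, AddSubmonoidClass.coe_finsetSum] at h
    have hp0 : ((p : ℚ_[p]) ^ n) ≠ 0 := pow_ne_zero _ (Nat.cast_ne_zero.mpr (Fact.out : p.Prime).ne_zero)
    have e : ∀ j : Fin f, ((c j • (φO ^ (j : ℕ)) ⟨_, hn⟩ : Valued.integer K) : K) =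
        ((p : ℚ_[p]) ^ n) • (algebraMap ℤ_[p] K (c j) * (φ ^ (j : ℕ)) x) := by
      intro j
      change algebraMap ℚ_[p] K (c j) * (((φO ^ (j : ℕ)) ⟨_, hn⟩ : Valued.integer K) : K) = _
      rw [coe_pow_restrict_apply φ φO hφO, map_smul, mul_smul_comm]
      rfl
    rw [Finset.sum_congr rfl (fun j _ => e j), ← Finset.smul_sum, smul_eq_zero] at h
    exact h.resolve_left hp0
  have hind := (linearIndependent_monoidHom K K).comp
    (fun j : Fin f => ((φ ^ (j : ℕ) : K →ₐ[ℚ_[p]] K) : K →* K)) (by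
      intro j j' hjj'
      have h := congrArg (fun g : K →* K => (g : K → K)) hjj'
      exact Fin.ext (hdist j j' j.2 j'.2 (by simpa using h)))
  rw [Fintype.linearIndependent_iff] at hind
  have h0 := hind (fun j => algebraMap ℤ_[p] K (c j)) (by
    funext x
    simp only [Finset.sum_apply, Pi.smul_apply, Function.comp_apply, smul_eq_mul, Pi.zero_apply,
      MonoidHom.coe_coe]
    exact hK x) i
  have h1 : ((c i : ℤ_[p]) : ℚ_[p]) = ((0 : ℤ_[p]) : ℚ_[p]) :=
    (algebraMap ℚ_[p] K).injective (by rw [PadicInt.coe_zero, map_zero]; exact h0)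
  exact Subtype.ext h1

omit [ProperSpace K] in
/-- The restriction `φO` of `φ` with `φ^f = 1` satisfies `φO^f = 1`. [folklore] -/
theorem pow_restrict_eq_one (φ : K →ₐ[ℚ_[p]] K)
    (φO : Valued.integer K →ₗ[ℤ_[p]] Valued.integer K) (hφO : ∀ x : Valued.integer K, (φO x : K) = φ x)
    {f : ℕ} (hpow : ∀ x, (φ ^ f) x = x) : φO ^ f = 1 := by
  ext x
  rw [coe_pow_restrict_apply φ φO hφO, hpow, Module.End.one_apply]

omit [ProperSpace K] in
/-- Compatibility of the Euler operators on `𝒪_K` and on `K`. [folklore] -/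
theorem coe_aeval_restrict_apply (φ : K →ₐ[ℚ_[p]] K)
    (φO : Valued.integer K →ₗ[ℤ_[p]] Valued.integer K) (hφO : ∀ x : Valued.integer K, (φO x : K) = φ x)
    (a q : ℤ) (x : Valued.integer K) :
    ((aeval φO (X ^ 2 - C (a : ℤ_[p]) * X + C (q : ℤ_[p])) x : Valued.integer K) : K) =
      aeval (φ : K →ₗ[ℚ_[p]] K) (X ^ 2 - C (a : ℚ_[p]) * X + C (q : ℚ_[p])) (x : K) := by
  rw [aeval_eulerPoly_apply, aeval_eulerPoly_apply]
  change (φO (φO x) : K) - algebraMap ℚ_[p] K ((a : ℤ_[p]) : ℚ_[p]) * (φO x : K)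
      + algebraMap ℚ_[p] K ((q : ℤ_[p]) : ℚ_[p]) * (x : K) =
    φ (φ x) - (a : ℚ_[p]) • φ x + (q : ℚ_[p]) • (x : K)
  rw [hφO, hφO, Algebra.smul_def, Algebra.smul_def, PadicInt.coe_intCast, PadicInt.coe_intCast]

/-- **The index of the Euler lattice.**  Let `K` be a `p`-adic field (normed `ℚ_p`-algebra, ultrametric,
proper) with `[K : ℚ_p] = f`, `φ` an isometric `ℚ_p`-algebra endomorphism with `φ^f = 1` whose powers
`φ⁰, …, φ^{f−1}` are pairwise distinct (the Frobenius of an unramified `K`), and `a, q ∈ ℤ` with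
`N := q^f + 1 − D_f(a; q) ≠ 0`.  Then the Euler lattice
`Λ = {y ∈ K : φ²y − a·φy + q·y ∈ 𝒪_K}` contains `𝒪_K` with index `[Λ : 𝒪_K] = p^{v_p(N)}`
(`= #(𝒪_K / (φ² − aφ + q)𝒪_K)`, `det = N` by `det_aeval_eulerPoly_of_charpoly_eq`, `χ_φ = X^f − 1`
by Dedekind independence).  For `a = a_p`, `q = p` this is the `p`-part of
`#Ẽ(𝔽_{p^f}) = p^f + 1 − (α^f + β^f)`. [folklore] -/
theorem relIndex_integer_eulerLattice (φ : K →ₐ[ℚ_[p]] K) (hφ : ∀ x, ‖φ x‖ = ‖x‖) {f : ℕ}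
    (hf0 : 0 < f) (hf : Module.finrank ℚ_[p] K = f) (hpow : ∀ x, (φ ^ f) x = x)
    (hdist : ∀ i j : ℕ, i < f → j < f → (⇑(φ ^ i) : K → K) = ⇑(φ ^ j) → i = j) (a q : ℤ)
    (hN : (q : ℤ_[p]) ^ f + 1 - (Polynomial.dickson 1 (q : ℤ_[p]) f).eval (a : ℤ_[p]) ≠ 0) :
    (Valued.integer K).toAddSubgroup.relIndex
        ((Valued.integer K).toAddSubgroup.comap
          (aeval (φ : K →ₗ[ℚ_[p]] K) (X ^ 2 - C (a : ℚ_[p]) * X + C (q : ℚ_[p]))).toAddMonoidHom) =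
      p ^ ((q : ℤ_[p]) ^ f + 1 - (Polynomial.dickson 1 (q : ℤ_[p]) f).eval (a : ℤ_[p])).valuation := by
  classical
  haveI := finiteDimensional p K
  obtain ⟨φO, hφO⟩ := exists_restrict_integer φ hφ
  -- the characteristic polynomial of `φ` on `𝒪_K`
  have hrank : Module.finrank ℤ_[p] (Valued.integer K) = f := by rw [finrank_integer p K, hf]
  have hχ : φO.charpoly = X ^ f - 1 :=
    charpoly_eq_X_pow_sub_one_of_linearIndependent φO hf0 hrank (pow_restrict_eq_one φ φO hφO hpow)
      (linearIndependent_pow_restrict φ φO hφO hdist)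
  -- the Euler operator on `𝒪_K` and on `K`
  set TO := aeval φO (X ^ 2 - C (a : ℤ_[p]) * X + C (q : ℤ_[p])) with hTO
  set TK := aeval (φ : K →ₗ[ℚ_[p]] K) (X ^ 2 - C (a : ℚ_[p]) * X + C (q : ℚ_[p])) with hTK
  have hcoe : ∀ x : Valued.integer K, ((TO x : Valued.integer K) : K) = TK (x : K) :=
    fun x => coe_aeval_restrict_apply φ φO hφO a q x
  have hcard := natCard_quotient_range_aeval_eulerPoly_of_charpoly_eq φO (a : ℤ_[p]) (q : ℤ_[p]) hχ hN
  have hinjO : Function.Injective TO :=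
    injective_of_det_ne_zero TO (by rw [hTO, det_aeval_eulerPoly_of_charpoly_eq φO _ _ hχ]; exact hN)
  -- `TK` is injective, hence bijective
  have hinjK : Function.Injective TK := by
    rw [← LinearMap.ker_eq_bot, Submodule.eq_bot_iff]
    intro y hy
    rw [LinearMap.mem_ker] at hy
    obtain ⟨n, hn⟩ := exists_pow_smul_mem_integer (p := p) y
    have h0 : TO ⟨_, hn⟩ = 0 := by
      apply Subtype.ext
      rw [hcoe, ZeroMemClass.coe_zero]
      change TK (((p : ℚ_[p]) ^ n) • y) = 0
      rw [map_smul, hy, smul_zero]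
    have h1 : ((p : ℚ_[p]) ^ n) • y = 0 := by
      have := congrArg (fun z : Valued.integer K => (z : K)) (hinjO (h0.trans (map_zero TO).symm))
      simpa using this
    exact (smul_eq_zero.mp h1).resolve_left
      (pow_ne_zero _ (Nat.cast_ne_zero.mpr (Fact.out : p.Prime).ne_zero))
  have hsurjK : Function.Surjective TK := LinearMap.injective_iff_surjective.mp hinjK
  -- the comparison homomorphism `Λ → 𝒪_K ⧸ TO(𝒪_K)`
  set Λ := (Valued.integer K).toAddSubgroup.comap TK.toAddMonoidHom with hΛ
  have hmemΛ : ∀ y : K, y ∈ Λ ↔ TK y ∈ Valued.integer K := fun y => Iff.rfl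
  let Θ : Λ →+ Valued.integer K ⧸ (LinearMap.range TO).toAddSubgroup :=
    { toFun := fun y => QuotientAddGroup.mk ⟨TK y, (hmemΛ y).mp y.2⟩
      map_zero' := by
        rw [← QuotientAddGroup.mk_zero]; congr 1; apply Subtype.ext
        simp
      map_add' := fun y z => by
        rw [← QuotientAddGroup.mk_add]; congr 1
        apply Subtype.ext
        simp only [map_add, AddMemClass.coe_add] }
  have hΘsurj : Function.Surjective Θ := by
    rintro ⟨o⟩
    obtain ⟨y, hy⟩ := hsurjK (o : K)
    refine ⟨⟨y, (hmemΛ y).mpr (by rw [hy]; exact o.2)⟩, ?_⟩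
    change QuotientAddGroup.mk _ = QuotientAddGroup.mk o
    congr 1
    exact Subtype.ext hy
  have hΘker : Θ.ker = (Valued.integer K).toAddSubgroup.addSubgroupOf Λ := by
    ext y
    rw [AddMonoidHom.mem_ker, AddSubgroup.mem_addSubgroupOf]
    change QuotientAddGroup.mk _ = (0 : Valued.integer K ⧸ (LinearMap.range TO).toAddSubgroup) ↔
      (y : K) ∈ Valued.integer K
    rw [QuotientAddGroup.eq_zero_iff]
    constructor
    · rintro ⟨o, ho⟩
      have h := congrArg (fun z : Valued.integer K => (z : K)) ho
      simp only [hcoe] at h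
      have hyo : (y : K) = o := hinjK h.symm
      rw [hyo]; exact o.2
    · intro hy
      refine ⟨⟨y, hy⟩, Subtype.ext ?_⟩
      simp only [hcoe]
  -- count
  rw [AddSubgroup.relIndex, ← hΘker, ← hcard]
  exact Nat.card_congr (QuotientAddGroup.quotientKerEquivOfSurjective Θ hΘsurj).toEquiv

end Summit.BirchSwinnertonDyer.BirchSwinnertonDyer.Theorems.KimAtThreeEulerLatticeIndex
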